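import Summits.QuantumFields.BalabanUV.Beta.D1BFx.PackedPinnedLetters

/-!
# `BalabanUV.Beta.D1BFx.PackedPinnedLettersLoc` — road «BF-x» for binder row D1, slot (K), chain step (I) «(A1)-PACKED», brick «COFRAME-PACK-2»,
# FILE P1b: **LOCALISATION ((u1)) AND ENTRYWISE LIMITS ((u2)) OF THE RESPONSE-WEIGHTED PINNED BOND KERNELS** `jetRw ω Y`, `jetCw ω Y`, `jetRCw ω ω′ Y`
# of FILE P1a `PackedPinnedLetters`, for a DECAYING site kernel `Y` and a weight decaying from the base point `P` (the two-tip table with a merely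
# BOUNDED second weight — the periodised one): bi-localised at `(P, P)` with rate `δ∕2`, constants free of any period; limits along entrywise
# convergent `Y_k → Y` and `ω′_k → ω′` (the periodised weight along `s_k → ∞`, `PeriodicArrayWrapLimit.tendsto_tsum_images`)

HONEST DEPENDENCY (cell records, verbatim): «continuum YM on T⁴ ⇐ BetaPertH ∧ nine spine estimates (0/9 proved); BetaPertH ⇐ (D1) ∧ (D4) ∧
CAP+tail; G-an2-4 gates asym, D1 and NE2/3/4.»  HONEST FRAMING (cell contract, verbatim): «discharging `BetaPertH` makes Bałaban's UV stability
UNCONDITIONAL — a real constructive-QFT result; it is NOT the continuum limit and NOT the Clay problem.»  THIS MODULE DISCHARGES NOTHING of (K),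
of D1 or of the wall: [folklore] exponential bookkeeping (`ExpKernelCalculus.l1_sub_triangle`) and `Filter.Tendsto` algebra.  No `def`, no `def … : Prop`,
nothing cited, 0 sorry.  0∕4 binders of row D1; (K) NOT closed; NOT D1, NOT BetaPertH, NOT continuum, NOT Clay.

ABSOLUTE RULE (cell charter, verbatim): «No internally-minted statement may enter as a cited fact. Every hypothesis is either kernel-proved in this
package or a verbatim quotation of a PUBLISHED theorem with page reference. The manuscript(s) under audit are NOT citable for their own disputed
steps — they are the thing under adjudication; programme-internal (2001/route/tribunal) claims are never citable.»

CONTENT: §1 `exp_weight_mul_exp_decay_le`, **`biLoc_jetRw_of_decays`**, **`biLoc_jetCw_of_decays`**, **`biLoc_jetRCw_of_decays`**;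
§2 **`tendsto_jetRw_apply`**, **`tendsto_jetCw_apply`**, **`tendsto_jetRCw_apply`**.  (The ARRAY case `Y := arr s X` of (u1) — the inter-word products of
the mixed jet — is FILE P3's, next to the product letters.)
Unit `b2b-balaban-beta-d1-formalise-leaf-03` (gen 23); road owner `b2b-balaban-beta-d1-p2` (W-d1p2-g18-4∕-5, journal l.40583).
-/

noncomputable section

namespace Summit.QuantumFields.BalabanUV.Beta.D1BFx.PackedPinnedLettersLoc

open Filter Topology
open scoped BigOperators
open Literature.MathematicalPhysics.QuantumFieldTheory.Balaban1983to89
open Literature.MathematicalPhysics.QuantumFieldTheory.Balaban1983to89.Beta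
open B12Sec2to5 (l1 l1_nonneg)
open ExpKernelCalculus (MKer BiLoc Decays l1_sub_triangle)
open AffineAveraging (unitVec)
open Summit.QuantumFields.BalabanUV.Beta.D1BFx.GhostStencil (l1_unitVec l1_zero)
open Summit.QuantumFields.BalabanUV.Beta.D1BFx.PackedPinnedLetters (jetRw jetCw jetRCw jetRw_apply jetCw_apply jetRCw_apply)

/-! ## §1 Localisation of the weighted pinned words (decaying `Y`) -/

section Loc

variable {ω ω' : Fin 4 → (Fin 4 → ℤ) → ℝ} {Y : MKer 4 Unit} {Cw B CY δ : ℝ} {P : Fin 4 → ℤ}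

/-- [folklore] The exponent bookkeeping of a weight at `x` against a kernel from `x + e` to `z′`, `|e|₁ ≤ 1`, `|z − z′|₁ ≤ 1`:
`e^{−δ|x−P|₁}·e^{−δ|x+e−z′|₁} ≤ e^{2δ}·e^{−(δ/2)(|x−P|₁ + |z−P|₁)}` (`0 ≤ δ`). -/
theorem exp_weight_mul_exp_decay_le (hδ : 0 ≤ δ) (x z z' e : Fin 4 → ℤ) (he : l1 e ≤ 1) (hz : l1 (z - z') ≤ 1) :
    Real.exp (-δ * l1 (x - P)) * Real.exp (-δ * l1 (x + e - z'))
      ≤ Real.exp (2 * δ) * Real.exp (-(δ / 2) * (l1 (x - P) + l1 (z - P))) := by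
  rw [← Real.exp_add, ← Real.exp_add]
  apply Real.exp_le_exp.mpr
  -- `|z − P| ≤ |z − z′| + |z′ − (x+e)| + |x + e − x| + |x − P| ≤ 2 + |x+e−z′| + |x−P|`
  have h1 : l1 (z - P) ≤ l1 (z - z') + l1 (z' - (x + e)) + l1 (x + e - x) + l1 (x - P) := by
    have := l1_sub_triangle z z' P
    have := l1_sub_triangle z' (x + e) P
    have := l1_sub_triangle (x + e) x P
    linarith
  have h2 : l1 (z' - (x + e)) = l1 (x + e - z') := l1_sub_comm _ _
  have h3 : l1 (x + e - x) = l1 e := by rw [add_sub_cancel_left]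
  have h4 := l1_nonneg (x - P)
  have h5 := l1_nonneg (x + e - z')
  nlinarith

/-- [folklore] **LOCALISATION OF THE ROW-WEIGHTED WORD, DECAYING `Y`**: `|ω α x| ≤ Cw·e^{−δ|x−P|₁}`, `Decays Y CY δ`, `0 ≤ δ` ⟹
`BiLoc (jetRw ω Y) P P (2·Cw·CY·e^{2δ}) (δ∕2)`. -/
theorem biLoc_jetRw_of_decays (hω : ∀ α x, |ω α x| ≤ Cw * Real.exp (-δ * l1 (x - P))) (hY : Decays Y CY δ) (hδ : 0 ≤ δ) :
    BiLoc (jetRw ω Y) P P (2 * Cw * CY * Real.exp (2 * δ)) (δ / 2) := by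
  intro x z α β
  have hCw : 0 ≤ Cw := le_trans (abs_nonneg _) ((hω α P).trans (by rw [sub_self, l1_zero, mul_zero, Real.exp_zero, mul_one]))
  have hCY : 0 ≤ CY := hY.nonneg ()
  rw [jetRw_apply, abs_mul]
  have hA := hY (x + unitVec α) (z + unitVec β) () ()
  have hB := hY (x + unitVec α) z () ()
  have eA := exp_weight_mul_exp_decay_le (P := P) hδ x z (z + unitVec β) (unitVec α) (by rw [l1_unitVec])
    (by rw [sub_add_cancel_left, Beta.l1_neg, l1_unitVec])
  have eB := exp_weight_mul_exp_decay_le (P := P) hδ x z z (unitVec α) (by rw [l1_unitVec]) (by rw [sub_self, l1_zero]; norm_num)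
  have hw := hω α x
  calc |ω α x| * |Y (x + unitVec α) (z + unitVec β) () () - Y (x + unitVec α) z () ()|
      ≤ (Cw * Real.exp (-δ * l1 (x - P))) * (CY * Real.exp (-δ * l1 (x + unitVec α - (z + unitVec β))) + CY * Real.exp (-δ * l1 (x + unitVec α - z))) :=
        mul_le_mul hw ((abs_sub _ _).trans (add_le_add hA hB)) (abs_nonneg _) (mul_nonneg hCw (Real.exp_pos _).le)
    _ = Cw * CY * (Real.exp (-δ * l1 (x - P)) * Real.exp (-δ * l1 (x + unitVec α - (z + unitVec β)))
          + Real.exp (-δ * l1 (x - P)) * Real.exp (-δ * l1 (x + unitVec α - z))) := by ring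
    _ ≤ Cw * CY * (Real.exp (2 * δ) * Real.exp (-(δ / 2) * (l1 (x - P) + l1 (z - P)))
          + Real.exp (2 * δ) * Real.exp (-(δ / 2) * (l1 (x - P) + l1 (z - P)))) :=
        mul_le_mul_of_nonneg_left (add_le_add eA eB) (mul_nonneg hCw hCY)
    _ = 2 * Cw * CY * Real.exp (2 * δ) * Real.exp (-(δ / 2) * (l1 (x - P) + l1 (z - P))) := by ring

/-- [folklore] **LOCALISATION OF THE COLUMN-WEIGHTED WORD, DECAYING `Y`**: `BiLoc (jetCw ω Y) P P (2·Cw·CY·e^{2δ}) (δ∕2)` (weights decaying from `P`). -/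
theorem biLoc_jetCw_of_decays (hω : ∀ β z, |ω β z| ≤ Cw * Real.exp (-δ * l1 (z - P))) (hY : Decays Y CY δ) (hδ : 0 ≤ δ) :
    BiLoc (jetCw ω Y) P P (2 * Cw * CY * Real.exp (2 * δ)) (δ / 2) := by
  intro x z α β
  have hCw : 0 ≤ Cw := le_trans (abs_nonneg _) ((hω β P).trans (by rw [sub_self, l1_zero, mul_zero, Real.exp_zero, mul_one]))
  have hCY : 0 ≤ CY := hY.nonneg ()
  rw [jetCw_apply, abs_mul]
  -- transpose the roles of `x` and `z`: `Decays` is symmetric in its two variables up to `l1_sub_comm`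
  have hA : |Y (x + unitVec α) (z + unitVec β) () ()| ≤ CY * Real.exp (-δ * l1 (z + unitVec β - (x + unitVec α))) := by
    rw [l1_sub_comm]; exact hY _ _ () ()
  have hB : |Y x (z + unitVec β) () ()| ≤ CY * Real.exp (-δ * l1 (z + unitVec β - x)) := by
    rw [l1_sub_comm]; exact hY _ _ () ()
  have eA := exp_weight_mul_exp_decay_le (P := P) hδ z x (x + unitVec α) (unitVec β) (by rw [l1_unitVec])
    (by rw [sub_add_cancel_left, Beta.l1_neg, l1_unitVec])
  have eB := exp_weight_mul_exp_decay_le (P := P) hδ z x x (unitVec β) (by rw [l1_unitVec]) (by rw [sub_self, l1_zero]; norm_num)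
  have hw := hω β z
  calc |ω β z| * |Y (x + unitVec α) (z + unitVec β) () () - Y x (z + unitVec β) () ()|
      ≤ (Cw * Real.exp (-δ * l1 (z - P))) * (CY * Real.exp (-δ * l1 (z + unitVec β - (x + unitVec α))) + CY * Real.exp (-δ * l1 (z + unitVec β - x))) :=
        mul_le_mul hw ((abs_sub _ _).trans (add_le_add hA hB)) (abs_nonneg _) (mul_nonneg hCw (Real.exp_pos _).le)
    _ = Cw * CY * (Real.exp (-δ * l1 (z - P)) * Real.exp (-δ * l1 (z + unitVec β - (x + unitVec α)))
          + Real.exp (-δ * l1 (z - P)) * Real.exp (-δ * l1 (z + unitVec β - x))) := by ring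
    _ ≤ Cw * CY * (Real.exp (2 * δ) * Real.exp (-(δ / 2) * (l1 (z - P) + l1 (x - P)))
          + Real.exp (2 * δ) * Real.exp (-(δ / 2) * (l1 (z - P) + l1 (x - P)))) :=
        mul_le_mul_of_nonneg_left (add_le_add eA eB) (mul_nonneg hCw hCY)
    _ = 2 * Cw * CY * Real.exp (2 * δ) * Real.exp (-(δ / 2) * (l1 (x - P) + l1 (z - P))) := by rw [add_comm (l1 (z - P))]; ring

/-- [folklore] **LOCALISATION OF THE TWO-TIP TABLE, DECAYING `Y`**: `|ω α x| ≤ Cw·e^{−δ|x−P|₁}`, `|ω′ β z| ≤ B` (a BOUNDED — e.g. periodised — second weight),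
`Decays Y CY δ` ⟹ `BiLoc (jetRCw ω ω′ Y) P P (Cw·B·CY·e^{2δ}) (δ∕2)`. -/
theorem biLoc_jetRCw_of_decays (hω : ∀ α x, |ω α x| ≤ Cw * Real.exp (-δ * l1 (x - P))) (hω' : ∀ β z, |ω' β z| ≤ B) (hY : Decays Y CY δ)
    (hδ : 0 ≤ δ) : BiLoc (jetRCw ω ω' Y) P P (Cw * B * CY * Real.exp (2 * δ)) (δ / 2) := by
  intro x z α β
  have hCw : 0 ≤ Cw := le_trans (abs_nonneg _) ((hω α P).trans (by rw [sub_self, l1_zero, mul_zero, Real.exp_zero, mul_one]))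
  have hB : 0 ≤ B := (abs_nonneg _).trans (hω' β z)
  have hCY : 0 ≤ CY := hY.nonneg ()
  rw [jetRCw_apply, abs_mul, abs_mul]
  have hA := hY (x + unitVec α) (z + unitVec β) () ()
  have eA := exp_weight_mul_exp_decay_le (P := P) hδ x z (z + unitVec β) (unitVec α) (by rw [l1_unitVec])
    (by rw [sub_add_cancel_left, Beta.l1_neg, l1_unitVec])
  calc |ω α x| * |ω' β z| * |Y (x + unitVec α) (z + unitVec β) () ()|
      ≤ (Cw * Real.exp (-δ * l1 (x - P))) * B * (CY * Real.exp (-δ * l1 (x + unitVec α - (z + unitVec β)))) :=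
        mul_le_mul (mul_le_mul (hω α x) (hω' β z) (abs_nonneg _) (mul_nonneg hCw (Real.exp_pos _).le)) hA (abs_nonneg _)
          (mul_nonneg (mul_nonneg hCw (Real.exp_pos _).le) hB)
    _ = Cw * B * CY * (Real.exp (-δ * l1 (x - P)) * Real.exp (-δ * l1 (x + unitVec α - (z + unitVec β)))) := by ring
    _ ≤ Cw * B * CY * (Real.exp (2 * δ) * Real.exp (-(δ / 2) * (l1 (x - P) + l1 (z - P)))) :=
        mul_le_mul_of_nonneg_left eA (mul_nonneg (mul_nonneg hCw hB) hCY)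
    _ = Cw * B * CY * Real.exp (2 * δ) * Real.exp (-(δ / 2) * (l1 (x - P) + l1 (z - P))) := by ring

end Loc

/-! ## §2 Entrywise limits -/

section Limits

variable {ω ω' : Fin 4 → (Fin 4 → ℤ) → ℝ} {Yk : ℕ → MKer 4 Unit} {Y : MKer 4 Unit} {ωk : ℕ → Fin 4 → (Fin 4 → ℤ) → ℝ}

/-- [folklore] **(u2) FOR `jetRw`**: if `Yk → Y` entrywise then `jetRw ω (Yk k) → jetRw ω Y` entrywise. -/
theorem tendsto_jetRw_apply (h : ∀ x z, Tendsto (fun k => Yk k x z () ()) atTop (𝓝 (Y x z () ()))) (x z : Fin 4 → ℤ) (α β : Fin 4) :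
    Tendsto (fun k => jetRw ω (Yk k) x z α β) atTop (𝓝 (jetRw ω Y x z α β)) := by
  simp only [jetRw_apply]
  exact ((h _ _).sub (h _ _)).const_mul _

/-- [folklore] **(u2) FOR `jetCw`**. -/
theorem tendsto_jetCw_apply (h : ∀ x z, Tendsto (fun k => Yk k x z () ()) atTop (𝓝 (Y x z () ()))) (x z : Fin 4 → ℤ) (α β : Fin 4) :
    Tendsto (fun k => jetCw ω (Yk k) x z α β) atTop (𝓝 (jetCw ω Y x z α β)) := by
  simp only [jetCw_apply]
  exact ((h _ _).sub (h _ _)).const_mul _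

/-- [folklore] **(u2) FOR `jetRCw` WITH A MOVING SECOND WEIGHT** (e.g. the periodised weight along `s_k → ∞`, `PeriodicArrayWrapLimit.tendsto_tsum_images`):
if `ωk k β z → ω′ β z` and `Yk → Y` entrywise then `jetRCw ω (ωk k) (Yk k) → jetRCw ω ω′ Y` entrywise. -/
theorem tendsto_jetRCw_apply (hω : ∀ β z, Tendsto (fun k => ωk k β z) atTop (𝓝 (ω' β z)))
    (h : ∀ x z, Tendsto (fun k => Yk k x z () ()) atTop (𝓝 (Y x z () ()))) (x z : Fin 4 → ℤ) (α β : Fin 4) :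
    Tendsto (fun k => jetRCw ω (ωk k) (Yk k) x z α β) atTop (𝓝 (jetRCw ω ω' Y x z α β)) := by
  simp only [jetRCw_apply]
  exact (((hω β z).const_mul _).mul (h _ _))

end Limits

end Summit.QuantumFields.BalabanUV.Beta.D1BFx.PackedPinnedLettersLoc

end
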